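import Literature.MathematicalPhysics.QuantumFieldTheory.Balaban1983to89.B6CubeWindowV1
import Literature.MathematicalPhysics.QuantumFieldTheory.Balaban1983to89.B6ScalarChartV1

/-!
# `Balaban1983to89.B6PadLevelV1` — T. Bałaban, *Propagators and renormalization transformations for lattice gauge theories. II*,
# Commun. Math. Phys. **96** (1984) 223–250 [Balaban1984PropagatorsII], (2.1)–(2.4) p. 224 (*"we admit the case when some domains Ω_j are equal to T_η
# … or are empty"*), (2.19)/(2.22) p. 226, (2.36) p. 229, (2.45)–(2.46) p. 231: LEVEL PADDING — a `k`-level torus family `Ω₁ ⊃ … ⊃ Ω_k` read as a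
# `(k+1)`-level family with `Ω_{k+1} = ∅` (top big blocks `L·S_k`, `P′ = L·P″`): the same `Λ_j`, the same index set `𝔅`, THE SAME `Δ_a` AND `G = Δ_a⁻¹`,
# the same blocks, admissible bonds and distance (2.46) — and in the padded family EVERY cube of the cover (2.36) lies below the top level, so r03's
# window construction `…B6CubeWindowV1` places it (`placed_of_lt`) for EVERY odd `L`

statement-level skeleton of published theorems with citation tags; proofs where landed; nothing here is a claim about the Yang–Mills mass gap

PDF held: `paper:balaban1984-cmp96-propagators-rt-ii` (journal page = PDF page + 222): p. 224 [PDF 2] ((2.1)–(2.4): *"a sequence of domains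
Ω₁ ⊃ Ω₂ ⊃ … ⊃ Ω_k … we admit the case when some domains Ω_j are equal to T_η"*), p. 226 [PDF 4] ((2.19), (2.22)), p. 229 [PDF 7] ((2.36)), p. 231 [PDF 9]
((2.45)–(2.46)); read from the tree transcriptions in `…B6SectADomainsV1`, `…B6SectAVectorModelV1`, `…B6GlobalChartV1`, `…B6Geom246MultiLevelTorus`.

CITATION HEADER (lean-in-tree rule) — WHAT IS REPRODUCED.  Phase-2 file of the `lit-balaban` typed skeleton (HOME `run/shared/lean/pub/lit-balaban/`), seat
**p38 gen 29** (literature-prover-lit-balaban-p38-g29-0), for the row owner r03's (R6) of B6-CLOSURE §5 item 15 («general-L top-cube placement»); SKELETON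
rows **B6.Prop2.6** × B6.Eq2.36 × B6.Eq2.19-2.22 × B6.Eq2.1-2.4 (cells only; decls of record untouched; referee ref-4).  THE POINT.  r03's member window of a
cube of the k-level cover (`…B6CubeWindowV1`) needs the cube PLACED (`Placed`: room `L·S_j/2` below its centre in the canonical index-`2` chart) — automatic
below the top level (`placed_of_lt`), for top cubes only when `L ≤ 5` (`placed_top`).  Instead of re-running the cube lane in the deeper chart `ccAt`, THIS
FILE pads the family by one EMPTY level: `padT D : TDomains d ℓ Mh (k+1) P″ R` (same level function, `P′ = L·P″`), for which every cube has level `≤ k <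
k + 1` (`placed_pad`), and proves that NOTHING ELSE CHANGES:
* §1 `SameOm D₁ D₂` (two V1 domain data with the same `Ω_j^{(j)}` at every level, ANY numbers of levels): `Λ_j` (sites/bonds), `N(Q′)` agree; the index sets
  `𝔅` are in bijection (`idxB`, level and bond kept); `Q`, `Q*`, `ΔN(Q′)`, **`R`**, **`Δ_a`** (2.19) and **`G = Δ_a⁻¹`** (2.22) AGREE (`QE_eq`, `QsE_UI`,
  `KE_eq`, `RE_eq`, `deltaAE_eq`, **`GE_eq`**) — the `v = 0`, `k`-free twin of r03's `…B6TranslateV1.IsTr` transport;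
* §2 `padT` (the padded torus family), `N0_pad` (`N₀` unchanged), `hN_pad`, `lev_lt_of_mem_cubes_pad`, **`placed_pad`** (every cube of the padded family is
  placed, `P″ ≥ 5`), and **`sameOm_domT_pad`**: r03's V1 domain datum `domT` of the padded family has the same `Ω_j` (level `k + 1` is empty because no site
  has level `k + 1`; `B6ScalarChartV1.exists_iterBlockOf_eq`);
* §3 the block geometry: `bset_pad` (same blocks `𝔅`), the relabelling `eT : 𝔅(D) ≃ 𝔅(padT D)` (identity on labels), `eT_blkV1`, `touchT_pad_iff`, the graph
  isomorphism `isoT` of the admissible bonds (2.46), hence (graph distance is invariant under isomorphism, a private helper) **`dist_eT`**, `pref_eT`, and the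
  transports **`hasMajorant_of_pad`** (a block majorant over the padded family is a block majorant over the family) and `globalBand_pad`.
No `def : Prop`, no new fact; definitions with bodies (`SameOm` — a `Prop`-valued structure, i.e. a hypothesis shape; `SameOm.idxB`, `SameOm.UI`, `padT`,
`eT`, `isoT`); standard axioms.

## HONEST SCOPE / DIVERGENCES

(1) Print allows `Ω_j = T_η` or trivial levels explicitly (p. 224); padding by an empty top level is bookkeeping, not mathematics: the operator `Δ_a` and its
inverse are LITERALLY unchanged (`GE_eq`).  (2) The padded family has top big blocks `S_{k+1} = L·S_k`, so the torus must consist of `P″_μ = P′_μ/L` of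
them: hypothesis `P′ = L·P″` (in the V1 setting `N₀ = 2L^{m+K}` forces `P′ ∈ {2L^n}`, so this is automatic once `P′ ≥ 2L`); `k + 1 ≤ m + K` likewise.
(3) The members `t(□)` built by `…B6CubeWindowV1` for the padded family chart a top cube at `S_k`-index `∈ [2L, 3L)` (room `≥ 2L·S_k ≥ L·S_k/2` below) —
the deeper chart (R6) asked for, obtained for free; below the top level the members are those of `D` verbatim (same chart vectors).  (4) Nothing on
d = 4 or the continuum; value = the placement hypothesis of the k-level (2.136)₁ made dischargeable for every odd `L ≥ 5` (consumer: `…B6Prop26KLevelAssemblyPadV1`);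
NOT summit progress.  Unit `lit-balaban-p38` (gen 29), 2026-08-23.
-/

noncomputable section

open scoped BigOperators InnerProductSpace
open Finset

namespace Literature.MathematicalPhysics.QuantumFieldTheory.Balaban1983to89.B6PadLevelV1

open LatticeFieldCalculus
open B5Eq118OneStroke (iterBlockOf)

/-! ## §1  Two V1 domain data with the same `Ω_j`: `Λ_j`, `𝔅`, `Q`, `Q*`, `R`, `Δ_a`, `G` agree -/

section SameOm

open B6SectADomainsV1 B6SectAOperatorsV1 B6SectAVectorModelV1
open BalabanImbrieJaffe1984to88.BIJ85AxialPropagator411 (BondSpace)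

variable {P : Params}

/-- **TWO NESTED FAMILIES WITH THE SAME DOMAINS `Ω_j^{(j)}` AT EVERY LEVEL** (possibly recorded with different numbers of levels `k`: the extra
levels are then empty — *"we admit the case when some domains Ω_j are equal to T_η"*, and symmetrically empty top domains change nothing).  A
`Prop`-valued structure (a hypothesis shape relating two data), the `v = 0`, `k`-free twin of `…B6TranslateV1.IsTr`.
[cite: Balaban1984PropagatorsII, (2.1)–(2.4) p.224, dictionary] -/
structure SameOm (D₁ D₂ : Domains P) : Prop where
  /-- `y ∈ Ω₂,n ↔ y ∈ Ω₁,n` at every level `n` -/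
  mem_Om : ∀ (n : ℕ) (y : Site P n), y ∈ D₂.Om n ↔ y ∈ D₁.Om n

variable {D₁ D₂ : Domains P} (h : SameOm D₁ D₂)
include h

/-- `Deep` agrees. [cite: Balaban1984PropagatorsII, (2.3) p.224, dictionary] -/
theorem SameOm.deep_iff {n : ℕ} (y : Site P n) : D₂.Deep n y ↔ D₁.Deep n y := by
  unfold Domains.Deep; rw [h.mem_Om]

/-- `Λ_n` (sites) agrees. [cite: Balaban1984PropagatorsII, (2.3) p.224, dictionary] -/
theorem SameOm.lamSite_iff {n : ℕ} (y : Site P n) : D₂.LamSite n y ↔ D₁.LamSite n y := by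
  unfold Domains.LamSite; rw [h.mem_Om, h.deep_iff]

/-- `Λ_n` (bonds) agrees. [cite: Balaban1984PropagatorsII, (2.3) p.224 («Ω also the set of bonds»), dictionary] -/
theorem SameOm.lamBond_iff {n : ℕ} (b : PBond P n) : D₂.LamBond n b ↔ D₁.LamBond n b := by
  unfold Domains.LamBond; rw [h.mem_Om, h.mem_Om, h.deep_iff, h.deep_iff]

/-- `N(Q′)` agrees ((2.7): the constraints `Q′_jλ = 0 on Λ_j` are the same). [cite: Balaban1984PropagatorsII, (2.7) p.224, (2.10) p.225] -/
theorem SameOm.inGauge_iff (lam : Site P 0 → ℝ) : D₂.InGauge lam ↔ D₁.InGauge lam := by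
  unfold Domains.InGauge
  exact forall_congr' fun n => forall_congr' fun y => by rw [h.lamSite_iff]

omit h in
/-- **`𝔅(Ω₂) ≃ 𝔅(Ω₁)` (BONDS)**: `(n, β) ↦ (n, β)` (the level bound is read off `Λ_n ≠ ∅ ⇒ n ≤ k`). [cite: Balaban1984PropagatorsII, (2.3) p.224 + (2.20) p.226, dictionary] -/
def SameOm.idxB (h : SameOm D₁ D₂) : BondIdx D₂ ≃ BondIdx D₁ where
  toFun i := ⟨⟨⟨(i.1.1 : ℕ), Nat.lt_succ_of_le (D₁.le_of_lamBond ((h.lamBond_iff i.1.2).1 i.2))⟩, i.1.2⟩, (h.lamBond_iff i.1.2).1 i.2⟩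
  invFun i := ⟨⟨⟨(i.1.1 : ℕ), Nat.lt_succ_of_le (D₂.le_of_lamBond ((h.lamBond_iff i.1.2).2 i.2))⟩, i.1.2⟩, (h.lamBond_iff i.1.2).2 i.2⟩
  left_inv _ := rfl
  right_inv _ := rfl

/-- the level of the image (plumbing; the statement shape coincides with `IsTr.idxB_fst`). [folklore] -/
@[simp] private theorem SameOm.idxB_fst (i : BondIdx D₂) : ((h.idxB i).1.1 : ℕ) = i.1.1 := rfl

/-- the bond of the image. [cite: Balaban1984PropagatorsII, (2.3) p.224, dictionary] -/
@[simp] theorem SameOm.idxB_snd (i : BondIdx D₂) : (h.idxB i).1.2 = i.1.2 := rfl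

omit h in
/-- **THE REINDEXING `L²(𝔅(Ω₁)) → L²(𝔅(Ω₂))`**, an isometry. [cite: Balaban1984PropagatorsII, (2.20) p.226, dictionary] -/
def SameOm.UI (h : SameOm D₁ D₂) : BondIdxSpace D₁ ≃ₗᵢ[ℝ] BondIdxSpace D₂ := LinearIsometryEquiv.piLpCongrLeft 2 ℝ ℝ h.idxB.symm

/-- `(U ω)(i) = ω(idxB i)` (plumbing). [folklore] -/
@[simp] private theorem SameOm.UI_apply (ω : BondIdxSpace D₁) (i : BondIdx D₂) : h.UI ω i = ω (h.idxB i) := rfl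

/-- **THE MULTI-SCALE `Q` (2.20) AGREES** up to the reindexing: `Q_{Ω₂} = U Q_{Ω₁}`. [cite: Balaban1984PropagatorsII, (2.20) p.226, (2.6) p.224] -/
theorem SameOm.QE_eq : QE D₂ = h.UI.toLinearEquiv.toLinearMap ∘ₗ QE D₁ := by
  apply LinearMap.ext; intro A; apply PiLp.ext; intro i; rfl

/-- pointwise `Q_{Ω₂} A = U (Q_{Ω₁} A)`. [cite: Balaban1984PropagatorsII, (2.20) p.226] -/
theorem SameOm.QE_apply_eq (A : BondSpace P) : QE D₂ A = h.UI (QE D₁ A) := LinearMap.congr_fun h.QE_eq A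

/-- the weights `a` agree with the pulled-back weights `w ∘ idxB` (plumbing). [folklore] -/
private theorem SameOm.aE_UI (w : BondIdx D₁ → ℝ) (ω : BondIdxSpace D₁) : aE D₂ (w ∘ h.idxB) (h.UI ω) = h.UI (aE D₁ w ω) := by
  apply PiLp.ext; intro i; rfl

/-- **`Q*` AGREES**: `Q*_{Ω₂} U = Q*_{Ω₁}`. [cite: Balaban1984PropagatorsII, (2.19)–(2.20) p.226 («Q* is the adjoint operator»)] -/
theorem SameOm.QsE_UI (ω : BondIdxSpace D₁) : QsE D₂ (h.UI ω) = QsE D₁ ω := by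
  apply ext_inner_right ℝ; intro x
  rw [inner_QsE_left, inner_QsE_left, h.QE_apply_eq x]
  exact h.UI.inner_map_map ω (QE D₁ x)

/-- **`Q*aQ` AGREES**: `Q*_{Ω₂} a(w ∘ idxB) Q_{Ω₂} = Q*_{Ω₁} a(w) Q_{Ω₁}`. [cite: Balaban1984PropagatorsII, (2.19) p.226] -/
theorem SameOm.QaQ_eq (w : BondIdx D₁ → ℝ) : QsE D₂ ∘ₗ aE D₂ (w ∘ h.idxB) ∘ₗ QE D₂ = QsE D₁ ∘ₗ aE D₁ w ∘ₗ QE D₁ := by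
  apply LinearMap.ext; intro A
  simp only [LinearMap.comp_apply]
  rw [h.QE_apply_eq A, h.aE_UI, h.QsE_UI]

/-- **`N(Q′) = ker Q′` AGREES**. [cite: Balaban1984PropagatorsII, (2.10) p.225] -/
theorem SameOm.ker_QpE_eq : LinearMap.ker (QpE D₂) = LinearMap.ker (QpE D₁) := by
  ext f; rw [mem_ker_QpE_iff, mem_ker_QpE_iff, h.inGauge_iff]

/-- **`ΔN(Q′)` AGREES**. [cite: Balaban1984PropagatorsII, (2.10) p.225] -/
theorem SameOm.KE_eq (c : ℝ) : KE D₂ c = KE D₁ c := by rw [KE, KE, h.ker_QpE_eq]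

/-- **`R` AGREES**: the orthogonal projection onto `ΔN(Q′)` is the same operator of `L²(T_η)`. [cite: Balaban1984PropagatorsII, (2.10)–(2.12) p.225] -/
theorem SameOm.RE_eq (c : ℝ) : RE D₂ c = RE D₁ c := by
  apply LinearMap.ext; intro f
  rw [RE_apply, RE_apply]
  apply Submodule.eq_starProjection_of_mem_orthogonal
  · rw [h.KE_eq]; exact Submodule.starProjection_apply_mem _ f
  · rw [h.KE_eq]; exact (KE D₁ c).sub_starProjection_mem_orthogonal f

/-- **`Δ_a` (2.19) AGREES**: `Δ_a(Ω₂, w ∘ idxB) = Δ_a(Ω₁, w)` as operators of `L²` of bonds. [cite: Balaban1984PropagatorsII, (2.19) p.226] -/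
theorem SameOm.deltaAE_eq (c : ℝ) (w : BondIdx D₁ → ℝ) : deltaAE D₂ c (w ∘ h.idxB) = deltaAE D₁ c w := by
  rw [deltaAE_def, deltaAE_def, h.RE_eq, h.QaQ_eq]

/-- **`G = Δ_a⁻¹` (2.22) AGREES**: `G(Ω₂, w ∘ idxB) = G(Ω₁, w)` (for any positivity witness of the pulled-back weights, e.g. `fun i => hw _`).
[cite: Balaban1984PropagatorsII, (2.22) p.226] -/
theorem SameOm.GE_eq {c : ℝ} (hc : c ≠ 0) {w : BondIdx D₁ → ℝ} (hw : ∀ i, 0 < w i) (hw' : ∀ i, 0 < (w ∘ h.idxB) i) :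
    GE D₂ hc hw' = GE D₁ hc hw := by
  apply LinearMap.ext; intro u
  conv_lhs => rw [← deltaAE_GE D₁ hc hw u]
  rw [← h.deltaAE_eq, GE_deltaAE]

end SameOm

/-! ## §2  The padded torus family: one more (empty) level, top big blocks `L·S_k`, the same `Ω_j`, every cube placed -/

section Pad

open B4Reflection242 (boxDom mem_boxDom blk)
open B6MultiLevelBoxOperator (Domains N0 bigSide)
open B6MultiLevelTorusOperator (TDomains)
open B6Cover236MultiLevelBlocks (cubes)
open B6GlobalChartV1 (PV toBox domT)
open B6ScalarChartV1 (exists_iterBlockOf_eq)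
open B6CubeWindowV1 (Placed placed_of_lt)

variable {d ℓ Mh k R : ℕ} {P' P'' : Fin (d + 1) → ℕ}

/-- **`N₀` IS UNCHANGED**: `P″·M_h·L^{k+2} = P′·M_h·L^{k+1}` for `P′ = L·P″`. [cite: Balaban1984PropagatorsII, (2.1) p.224, bookkeeping] -/
theorem N0_pad (hLP : ∀ μ, P' μ = (ℓ + 1) * P'' μ) : N0 ℓ Mh (k + 1) P'' = N0 ℓ Mh k P' := by
  funext μ; simp only [N0, hLP μ, pow_succ]; ring

/-- **THE PADDED TORUS FAMILY** `Ω₁ ⊃ … ⊃ Ω_k ⊃ Ω_{k+1} := ∅`: the same level function read as a `(k+1)`-level family of the same torus (top big blocks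
`S_{k+1} = L·S_k`, `P″ = P′/L` of them per direction); (2.1) at level `k + 1` and (2.2) towards level `k + 1` are void.
[cite: Balaban1984PropagatorsII, (2.1)–(2.4) p.224 («we admit the case when some domains Ω_j are equal to T_η»)] -/
def padT (D : TDomains d ℓ Mh k P' R) (hLP : ∀ μ, P' μ = (ℓ + 1) * P'' μ) : TDomains d ℓ Mh (k + 1) P'' R where
  lev := D.lev
  one_le_lev := D.one_le_lev
  lev_le x := (D.lev_le x).trans (Nat.le_succ k)
  bigBlocks j hj x hx x' hx' hblk := by
    rw [N0_pad hLP] at hx hx'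
    by_cases hjk : j ≤ k
    · exact D.bigBlocks j hj x hx x' hx' hblk
    · exact iff_of_false (fun h => hjk (h.trans (D.lev_le x))) (fun h => hjk (h.trans (D.lev_le x')))
  sepT j x hx x' hx' h1 h2 := by
    rw [N0_pad hLP] at hx hx' ⊢
    exact D.sepT j x hx x' hx' h1 h2

/-- the padded family has the level function of `D`. [cite: Balaban1984PropagatorsII, (2.3)–(2.4) p.224] -/
@[simp] theorem padT_lev (D : TDomains d ℓ Mh k P' R) (hLP : ∀ μ, P' μ = (ℓ + 1) * P'' μ) : (padT D hLP).lev = D.lev := rfl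

variable {m K : ℕ} {hd : 1 ≤ d + 1} {hL : Odd (ℓ + 1) ∧ 1 < ℓ + 1}

/-- the fundamental box of the padded family IS the V1 torus (same `N₀`). [cite: Balaban1984PropagatorsII, (2.1) p.224, dictionary] -/
theorem hN_pad (hN : ∀ μ, N0 ℓ Mh k P' μ = (PV d ℓ m K hd hL).sitesPerDir 0) (hLP : ∀ μ, P' μ = (ℓ + 1) * P'' μ) :
    ∀ μ, N0 ℓ Mh (k + 1) P'' μ = (PV d ℓ m K hd hL).sitesPerDir 0 := fun μ => by
  rw [N0_pad hLP]; exact hN μ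

/-- **EVERY CUBE OF THE PADDED FAMILY LIES BELOW ITS TOP LEVEL** (no site has level `k + 1`). [cite: Balaban1984PropagatorsII, (2.36) p.229, (2.3) p.224] -/
theorem lev_lt_of_mem_cubes_pad (D : TDomains d ℓ Mh k P' R) (hLP : ∀ μ, P' μ = (ℓ + 1) * P'' μ) (c : ↥(cubes (padT D hLP).toDomains)) :
    c.1.1 < k + 1 := by
  obtain ⟨x, _, hx⟩ := Finset.mem_image.1 c.2
  rw [← hx]
  exact Nat.lt_succ_of_le (D.lev_le x)

/-- **EVERY CUBE OF THE PADDED FAMILY IS PLACED** (`P″_μ ≥ 5`): r03's `placed_of_lt`, the top cubes of `D` being level-`k < k + 1` cubes of `padT D` — their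
canonical chart puts them at `S_k`-index `∈ [2L, 3L)`, with room `≥ 2L·S_k` below. [cite: Balaban1984PropagatorsII, p.229 («cubes □ of the size 2ML^jη»), p.238, dictionary (charts)] -/
theorem placed_pad (D : TDomains d ℓ Mh k P' R) (hLP : ∀ μ, P' μ = (ℓ + 1) * P'' μ) (hP5 : ∀ μ, 5 ≤ P'' μ)
    (c : ↥(cubes (padT D hLP).toDomains)) : Placed ℓ (k + 1) P'' c.1 :=
  placed_of_lt hP5 c.1 (lev_lt_of_mem_cubes_pad D hLP c)

/-- **r03's V1 DOMAIN DATUM OF THE PADDED FAMILY HAS THE SAME `Ω_j`**: `Ω_j^{(j)}(padT D) = Ω_j^{(j)}(D)` for `j ≤ k` (same level function), and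
`Ω_{k+1}^{(k+1)}(padT D) = ∅ = Ω_{k+1}^{(k+1)}(D)` (every `(k+1)`-block has a fine site, of level `≤ k`; `k + 1 ≤ m + K`).
[cite: Balaban1984PropagatorsII, (2.1)–(2.4) p.224] -/
theorem sameOm_domT_pad (hN : ∀ μ, N0 ℓ Mh k P' μ = (PV d ℓ m K hd hL).sitesPerDir 0) (D : TDomains d ℓ Mh k P' R) (hk : k ≤ m + K)
    (hLP : ∀ μ, P' μ = (ℓ + 1) * P'' μ) (hk' : k + 1 ≤ m + K) :
    SameOm (domT hN D hk) (domT (hN_pad hN hLP) (padT D hLP) hk') where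
  mem_Om n y := by
    classical
    by_cases hn0 : n = 0
    · subst hn0; simp [domT]
    by_cases hnk : n ≤ k
    · have hnk' : n ≤ k + 1 := by omega
      simp only [domT, hn0, if_false, hnk, hnk', if_true, Finset.mem_filter, Finset.mem_univ, true_and]
      exact Iff.rfl
    by_cases hnk1 : n = k + 1
    · subst hnk1
      simp only [domT, hn0, if_false, hnk, le_refl, if_true, Finset.mem_filter, Finset.mem_univ, true_and, Finset.notMem_empty,
        iff_false]
      obtain ⟨x, hx⟩ := exists_iterBlockOf_eq (d := d) (ℓ := ℓ) (hd := hd) (hL := hL) hk' y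
      intro hall
      have h1 := hall x hx
      have h2 := D.lev_le (toBox (hN_pad hN hLP) x : Fin (d + 1) → ℤ)
      simp only [padT_lev] at h1
      omega
    · have hnk2 : ¬ n ≤ k + 1 := by omega
      simp [domT, hn0, hnk, hnk2]

end Pad

/-! ## §3  The block geometry of the padded family: same blocks, same admissible bonds, same distance (2.46) -/

section Geometry

open B4Reflection242 (boxDom mem_boxDom blk)
open B6MultiLevelBoxOperator (Domains N0 bigSide)
open B6MultiLevelTorusOperator (TDomains)
open B6Geom246MultiLevelBox (bset blkOf blkOf_val)
open B6Geom246MultiLevelTorus (geomT bondT TouchT bondT_adj)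
open B6RandomWalk (HasMajorant BlockSupp)
open B6GlobalChartV1 (PV toBox domT blkV1)
open B6SectAOperatorsV1 (BondIdx)
open B6Prop26KLevelSkeletonV1 (pref)
open B6CubeWindowV1 (GlobalBand)

/-- a graph isomorphism does not increase the graph distance (a shortest walk maps to a walk of the same length). [folklore] -/
private theorem dist_iso_le {V W : Type*} {G : SimpleGraph V} {G' : SimpleGraph W} (φ : G ≃g G') (u v : V) : G'.dist (φ u) (φ v) ≤ G.dist u v := by
  by_cases hr : G.Reachable u v
  · obtain ⟨p, hp⟩ := hr.exists_walk_length_eq_dist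
    rw [← hp, ← SimpleGraph.Walk.length_map φ.toHom p]
    exact SimpleGraph.dist_le _
  · have hr' : ¬ G'.Reachable (φ u) (φ v) := fun h' => hr (SimpleGraph.Iso.reachable_iff.1 h')
    rw [SimpleGraph.dist_eq_zero_of_not_reachable hr, SimpleGraph.dist_eq_zero_of_not_reachable hr']

/-- **GRAPH DISTANCE IS INVARIANT UNDER A GRAPH ISOMORPHISM** (both ways). [folklore] -/
private theorem dist_iso {V W : Type*} {G : SimpleGraph V} {G' : SimpleGraph W} (φ : G ≃g G') (u v : V) : G'.dist (φ u) (φ v) = G.dist u v := by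
  refine le_antisymm (dist_iso_le φ u v) ?_
  have h2 := dist_iso_le φ.symm (φ u) (φ v)
  rwa [RelIso.symm_apply_apply, RelIso.symm_apply_apply] at h2

variable {d ℓ Mh k R : ℕ} {P' P'' : Fin (d + 1) → ℕ} {m K : ℕ} {hd : 1 ≤ d + 1} {hL : Odd (ℓ + 1) ∧ 1 < ℓ + 1}
/-- the fundamental box is unchanged. [cite: Balaban1984PropagatorsII, (2.1) p.224, bookkeeping] -/
theorem boxDom_pad (hLP : ∀ μ, P' μ = (ℓ + 1) * P'' μ) : boxDom (N0 ℓ Mh (k + 1) P'') = boxDom (N0 ℓ Mh k P') := by rw [N0_pad hLP]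

variable (D : TDomains d ℓ Mh k P' R) (hLP : ∀ μ, P' μ = (ℓ + 1) * P'' μ)

/-- **THE BLOCKS `𝔅` ARE UNCHANGED** (same level function on the same box). [cite: Balaban1984PropagatorsII, (2.45) p.231, (2.1) p.224] -/
theorem bset_pad : bset (padT D hLP).toDomains = bset D.toDomains := by
  unfold bset
  rw [N0_pad hLP]
  rfl

/-- **THE RELABELLING `𝔅(D) ≃ 𝔅(padT D)`** (identity on the pairs `(j, y)`). [cite: Balaban1984PropagatorsII, (2.45) p.231, dictionary] -/
def eT : ↥(bset D.toDomains) ≃ ↥(bset (padT D hLP).toDomains) :=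
  Equiv.subtypeEquivRight fun y => by rw [bset_pad D hLP]

/-- the relabelling keeps the pair `(j, y)`. [cite: Balaban1984PropagatorsII, (2.45) p.231, dictionary] -/
@[simp] theorem eT_val (y : ↥(bset D.toDomains)) : ((eT D hLP y : ↥(bset (padT D hLP).toDomains)) : ℕ × (Fin (d + 1) → ℤ)) = y.1 := rfl

/-- **THE BLOCK MAP OF THE FINE BONDS IS UNCHANGED**: `y(b₋)` read in the padded family is the relabelled `y(b₋)`.
[cite: Balaban1984PropagatorsII, p.231 («d(x, x′) = d(y, y′) if x ∈ B^j(y)»), dictionary] -/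
theorem eT_blkV1 (hN : ∀ μ, N0 ℓ Mh k P' μ = (PV d ℓ m K hd hL).sitesPerDir 0) (b : PBond (PV d ℓ m K hd hL) 0) :
    eT D hLP (blkV1 hN D b) = blkV1 (hN_pad hN hLP) (padT D hLP) b :=
  Subtype.ext rfl

/-- **TOUCHING IS UNCHANGED**: two blocks touch on the torus of the padded family iff they touch on the torus (same sites, same period `N₀`).
[cite: Balaban1984PropagatorsII, (2.46) p.231 («admissible bonds»), dictionary] -/
theorem touchT_pad_iff (s t : ↥(bset D.toDomains)) : TouchT (padT D hLP) (eT D hLP s) (eT D hLP t) ↔ TouchT D s t := by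
  unfold TouchT
  constructor
  · rintro ⟨x, x', hx, hx', hd'⟩
    refine ⟨⟨x.1, by rw [← boxDom_pad (ℓ := ℓ) (Mh := Mh) (k := k) hLP]; exact x.2⟩,
      ⟨x'.1, by rw [← boxDom_pad (ℓ := ℓ) (Mh := Mh) (k := k) hLP]; exact x'.2⟩, ?_, ?_, ?_⟩
    · apply Subtype.ext
      have e1 := congrArg Subtype.val hx
      simp only [blkOf_val, eT_val, TDomains.toDomains_lev, padT_lev] at e1 ⊢
      exact e1
    · apply Subtype.ext
      have e1 := congrArg Subtype.val hx'
      simp only [blkOf_val, eT_val, TDomains.toDomains_lev, padT_lev] at e1 ⊢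
      exact e1
    · show B4TorusKernel.MultiPeriod.torusSupNorm (N0 ℓ Mh k P') (x.1 - x'.1) ≤ 1
      rw [← N0_pad hLP]; exact hd'
  · rintro ⟨x, x', hx, hx', hd'⟩
    refine ⟨⟨x.1, by rw [boxDom_pad (ℓ := ℓ) (Mh := Mh) (k := k) hLP]; exact x.2⟩,
      ⟨x'.1, by rw [boxDom_pad (ℓ := ℓ) (Mh := Mh) (k := k) hLP]; exact x'.2⟩, ?_, ?_, ?_⟩
    · apply Subtype.ext
      have e1 := congrArg Subtype.val hx
      simp only [blkOf_val, eT_val, TDomains.toDomains_lev, padT_lev] at e1 ⊢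
      exact e1
    · apply Subtype.ext
      have e1 := congrArg Subtype.val hx'
      simp only [blkOf_val, eT_val, TDomains.toDomains_lev, padT_lev] at e1 ⊢
      exact e1
    · show B4TorusKernel.MultiPeriod.torusSupNorm (N0 ℓ Mh (k + 1) P'') (x.1 - x'.1) ≤ 1
      rw [N0_pad hLP]; exact hd'

/-- **THE ADMISSIBLE BONDS (2.46) OF THE PADDED FAMILY ARE THOSE OF THE FAMILY**: the relabelling is a graph isomorphism.
[cite: Balaban1984PropagatorsII, (2.46) p.231] -/
def isoT : bondT D ≃g bondT (padT D hLP) where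
  toEquiv := eT D hLP
  map_rel_iff' := by
    intro a b
    show (bondT (padT D hLP)).Adj (eT D hLP a) (eT D hLP b) ↔ (bondT D).Adj a b
    rw [bondT_adj, bondT_adj, touchT_pad_iff, ne_eq, (eT D hLP).injective.eq_iff]

/-- **THE DISTANCE (2.46) IS UNCHANGED**: `d_{padT D}(y, y′) = d_D(y, y′)`. [cite: Balaban1984PropagatorsII, (2.46) p.231] -/
theorem dist_eT (a b : ↥(bset D.toDomains)) : (geomT (padT D hLP)).dist (eT D hLP a) (eT D hLP b) = (geomT D).dist a b := by
  show (((bondT (padT D hLP)).dist (isoT D hLP a) (isoT D hLP b) : ℕ) : ℝ) = (((bondT D).dist a b : ℕ) : ℝ)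
  rw [dist_iso]

/-- the prefactor `(L^{j(y)}/c′)²` of (2.136) is unchanged (same level). [cite: Balaban1984PropagatorsII, (2.136) p.247, bookkeeping] -/
theorem pref_eT (cf : ℝ) (y : ↥(bset D.toDomains)) : pref cf (D := padT D hLP) (eT D hLP y) = pref cf (D := D) y := rfl

/-- **A BLOCK MAJORANT OVER THE PADDED FAMILY IS A BLOCK MAJORANT OVER THE FAMILY** (same blocks, same block map of the fine bonds): the printed
shape *"|(Tλ)(x)| ≤ K(y, y′)|λ|, x ∈ B^j(y), supp λ ⊂ B^{j′}(y′)"* does not see the empty level. [cite: Balaban1984PropagatorsII, (2.51) p.232, (2.136) p.247] -/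
theorem hasMajorant_of_pad (hN : ∀ μ, N0 ℓ Mh k P' μ = (PV d ℓ m K hd hL).sitesPerDir 0) {T : Module.End ℝ (PBond (PV d ℓ m K hd hL) 0 → ℝ)}
    {Kk : (geomT (padT D hLP)).Site → (geomT (padT D hLP)).Site → ℝ}
    (h : HasMajorant (g := geomT (padT D hLP)) (blkV1 (hN_pad hN hLP) (padT D hLP)) T Kk) :
    HasMajorant (g := geomT D) (blkV1 hN D) T (fun a b => Kk (eT D hLP a) (eT D hLP b)) := by
  intro y' μ B hB x
  have hB' : BlockSupp (g := geomT (padT D hLP)) (blkV1 (hN_pad hN hLP) (padT D hLP)) μ (eT D hLP y') B :=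
    ⟨hB.nonneg, fun x hx => hB.bound x ((eT D hLP).injective (by rw [eT_blkV1 D hLP hN]; exact hx)),
      fun x hx => hB.off x fun h' => hx (by rw [← eT_blkV1 D hLP hN, h'])⟩
  have := h (eT D hLP y') μ B hB' x
  rwa [← eT_blkV1 D hLP hN] at this

/-- **THE GLOBAL WEIGHT BAND IS UNCHANGED** under the reindexing of `𝔅` (same level of every index bond). [cite: Balaban1984PropagatorsII, (2.16) p.225, bookkeeping] -/
theorem globalBand_pad (hN : ∀ μ, N0 ℓ Mh k P' μ = (PV d ℓ m K hd hL).sitesPerDir 0) (hk : k ≤ m + K) (hk' : k + 1 ≤ m + K)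
    {b₀ b₁ cf : ℝ} {w : BondIdx (domT hN D hk) → ℝ} (hwb : GlobalBand b₀ b₁ cf w) :
    GlobalBand b₀ b₁ cf (w ∘ (sameOm_domT_pad hN D hk hLP hk').idxB) := by
  intro i
  have key := hwb ((sameOm_domT_pad hN D hk hLP hk').idxB i)
  simp only [Function.comp_apply, SameOm.idxB_fst] at key ⊢
  exact key

end Geometry

end Literature.MathematicalPhysics.QuantumFieldTheory.Balaban1983to89.B6PadLevelV1

end
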